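import Literature.Geometry.Riemannian.DirectionalBarrierMinimumPrinciple
import HarnessLib

/-!
# Chain rule for directional barrier data: lower barriers of `e^{-λ(t-t₁)} Φ(ψ)` from upper
# barriers of `ψ` for a non-increasing `Φ` (Bamler 2020a, §9, the subsolution
# `e^{-λ(t-t₁)} φ(d_t(x₀, ·)/r)`)

R. Bamler, *Entropy and heat kernel bounds on a Ricci flow background*, arXiv:2008.07093 (2020a),
§9 (arXiv Lemma 37): to show that `H_n`-centres stay near the basepoint one needs `□u ≤ 0` in
the barrier sense for `u(y, t) = e^{−λ(t−t₁)} Φ(ψ(y, t))` with `ψ = d_t(x₀, ·)²` and `Φ`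
non-increasing. The geometric input (upper barriers of `ψ` along geodesics in an orthonormal
frame, with the sum of second derivatives `≤ S`, exact first derivatives `2D` in one frame
direction and `0` in the others, and an upper left time barrier of slope `≥ −Pl`) is the datum
consumed/produced by the tree's directional barrier principles
(`directional_barrier_minimum_principle`, `directional_barrier_maximum_principle`). This file is
the pure one-variable calculus turning such a `ψ`-datum into the datum of LOWER barriers for `u`
(`directional_lower_barriers_of_antitone_comp`): with `U i σ := e^{−λ(t−t₁)} Φ(B i σ)` and
`Ut t' := e^{−λ(t'−t₁)} Φ(Bt t')` (chain and product rules), antitonicity of `Φ` turns upper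
barriers of `ψ` into lower barriers of `u`, and the pointwise differential inequality
`−Φ′(Pl + S) − (2D)² Φ″ ≤ λ Φ` at `q₀ = ψ(y, t)` gives `pu − Σ bu ≤ η`.

Everything is proved; no definitions, no named facts.

## References

* R. H. Bamler, *Entropy and heat kernel bounds on a Ricci flow background*, arXiv:2008.07093
  (2020), §9 (arXiv Lemma 37). [Bamler2020Entropy]
-/

noncomputable section

open Set Filter Function
open scoped Manifold ContDiff Topology

namespace Literature.Geometry.Riemannian

open Lorentzian Lorentzian.PseudoRiemannianMetric

/-! ### One-variable calculus helpers -/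

/-- Chain rule along an upper barrier: if `B` is differentiable near `0` with `B 0 = q₀` and `Φ`
is differentiable near `q₀`, then `σ ↦ c * Φ (B σ)` is differentiable near `0` with derivative
`c * (Φ' (B σ) * B' σ)`. [folklore] -/
theorem eventually_hasDerivAt_const_mul_comp {Φ Φ' B B' : ℝ → ℝ} {q₀ c : ℝ}
    (hΦ1 : ∀ᶠ q in 𝓝 q₀, HasDerivAt Φ (Φ' q) q)
    (hB : ∀ᶠ σ in 𝓝 (0 : ℝ), HasDerivAt B (B' σ) σ) (hB0 : B 0 = q₀) :
    ∀ᶠ σ in 𝓝 (0 : ℝ), HasDerivAt (fun σ ↦ c * Φ (B σ)) (c * (Φ' (B σ) * B' σ)) σ := by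
  have hBd0 : HasDerivAt B (B' 0) 0 := hB.self_of_nhds
  have hBc : Tendsto B (𝓝 0) (𝓝 q₀) := by
    have := hBd0.continuousAt
    rwa [ContinuousAt, hB0] at this
  filter_upwards [hB, hBc.eventually hΦ1] with σ hσ hΦσ
  exact (hΦσ.comp σ hσ).const_mul c

/-- Second derivative at `0` of `σ ↦ c * Φ (B σ)`: the derivative `σ ↦ c * (Φ' (B σ) * B' σ)` has
derivative `c * (Φ''₀ * B' 0 * B' 0 + Φ' (B 0) * b)` at `0`. [folklore] -/
theorem hasDerivAt_const_mul_deriv_comp {Φ' B B' : ℝ → ℝ} {Φ''₀ b c : ℝ}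
    (hΦ2 : HasDerivAt Φ' Φ''₀ (B 0)) (hB : HasDerivAt B (B' 0) 0) (hB2 : HasDerivAt B' b 0) :
    HasDerivAt (fun σ ↦ c * (Φ' (B σ) * B' σ)) (c * (Φ''₀ * B' 0 * B' 0 + Φ' (B 0) * b)) 0 :=
  ((hΦ2.comp 0 hB).mul hB2).const_mul c

/-- Product/chain rule for the time barrier: the left derivative at `t` of
`t' ↦ e^{−λ(t'−t₁)} Φ(Bt t')`. [folklore] -/
theorem hasDerivWithinAt_exp_mul_comp {Φ Bt : ℝ → ℝ} {Φ'₀ p lam t₁ t : ℝ}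
    (hΦ : HasDerivAt Φ Φ'₀ (Bt t)) (hBt : HasDerivWithinAt Bt p (Iic t) t) :
    HasDerivWithinAt (fun t' ↦ Real.exp (-lam * (t' - t₁)) * Φ (Bt t'))
      (Real.exp (-lam * (t - t₁)) * (-lam * Φ (Bt t) + Φ'₀ * p)) (Iic t) t := by
  have h1 : HasDerivAt (fun t' ↦ -lam * (t' - t₁)) (-lam * 1) t :=
    ((hasDerivAt_id t).sub_const t₁).const_mul (-lam)
  have h2 : HasDerivWithinAt (fun t' ↦ Real.exp (-lam * (t' - t₁)) * Φ (Bt t'))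
      (Real.exp (-lam * (t - t₁)) * (-lam * 1) * Φ (Bt t) +
        Real.exp (-lam * (t - t₁)) * (Φ'₀ * p)) (Iic t) t :=
    (h1.exp.hasDerivWithinAt (s := Iic t)).mul (hΦ.comp_hasDerivWithinAt t hBt)
  exact h2.congr_deriv (by ring)

/-! ### The chain rule for directional barrier data -/

/-- **Lower barriers for `e^{−λ(t−t₁)} Φ(ψ)` from upper barriers of `ψ`** (the calculus behind
Bamler 2020a, §9, arXiv Lemma 37). Let `Φ` be non-increasing, differentiable near `q₀ = ψ(y, t)`
with `Φ′` differentiable at `q₀`, `Φ′(q₀) ≤ 0` and `−Φ′(q₀)(Pl + S) − (2D)² Φ″(q₀) ≤ λ Φ(q₀)`.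
Suppose that for every `η₀ > 0` there is an `h(t)`-orthonormal frame `e` at `y`, upper barriers
`B i ≥ ψ(exp_y(σ eᵢ), t)` near `σ = 0`, touching, with derivatives `B' i` near `0`, second
derivatives `b i` at `0`, exact first derivatives `B' i₀ 0 = 2D`, `B' i 0 = 0` (`i ≠ i₀`), an upper
left time barrier `Bt ≥ ψ(y, ·)` with left derivative `p`, and `Σ b ≤ S + η₀`, `p ≥ −Pl − η₀`.
Then for every `η > 0` the function `u(y', t') = e^{−λ(t'−t₁)} Φ(ψ(y', t'))` has, at `(y, t)`, a
datum of LOWER barriers `U i`, `Ut` in the same frame with `pu − Σ bu ≤ η`.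
[cite: Bamler2020Entropy, §9 (arXiv Lemma 37)] -/
theorem directional_lower_barriers_of_antitone_comp
    {E : Type*} [NormedAddCommGroup E] [NormedSpace ℝ E] [FiniteDimensional ℝ E]
    [CompleteSpace E] {H : Type*} [TopologicalSpace H] {I : ModelWithCorners ℝ E H} [I.Boundaryless]
    {M : Type*} [TopologicalSpace M] [ChartedSpace H M] [IsManifold I ∞ M] [T2Space M]
    {h : ℝ → PseudoRiemannianMetric I ∞ E (TangentSpace I : M → Type _)}
    [∀ r, (h r).HasLeviCivita]
    {ψ : M → ℝ → ℝ} {Φ Φ' : ℝ → ℝ} {Φ''₀ lam t₁ : ℝ} {y : M} {t : ℝ}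
    (hΦanti : Antitone Φ) (hΦ1 : ∀ᶠ q in 𝓝 (ψ y t), HasDerivAt Φ (Φ' q) q)
    (hΦ2 : HasDerivAt Φ' Φ''₀ (ψ y t)) (hΦ'0 : Φ' (ψ y t) ≤ 0) {S Pl D : ℝ}
    (hΦineq : -Φ' (ψ y t) * (Pl + S) - (2 * D) ^ 2 * Φ''₀ ≤ lam * Φ (ψ y t))
    (hdat : ∀ η₀ > 0, ∃ (e : Fin (Module.finrank ℝ E) → TangentSpace I y)
        (B B' : Fin (Module.finrank ℝ E) → ℝ → ℝ) (b : Fin (Module.finrank ℝ E) → ℝ)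
        (Bt : ℝ → ℝ) (p : ℝ) (i₀ : Fin (Module.finrank ℝ E)),
      (∀ i j, (h t).val y (e i) (e j) = if i = j then 1 else 0) ∧
      (∀ i, (∀ᶠ σ in 𝓝 (0 : ℝ), HasDerivAt (B i) (B' i σ) σ) ∧ HasDerivAt (B' i) (b i) 0 ∧
        B i 0 = ψ y t ∧
        ∀ᶠ σ in 𝓝 (0 : ℝ), ψ (expMap (h t).leviCivita y (σ • e i)) t ≤ B i σ) ∧
      B' i₀ 0 = 2 * D ∧ (∀ i, i ≠ i₀ → B' i 0 = 0) ∧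
      (HasDerivWithinAt Bt p (Iic t) t ∧ Bt t = ψ y t ∧ ∀ᶠ t' in 𝓝[<] t, ψ y t' ≤ Bt t') ∧
      ∑ i, b i ≤ S + η₀ ∧ -Pl - η₀ ≤ p) :
    ∀ η > 0, ∃ (e : Fin (Module.finrank ℝ E) → TangentSpace I y)
        (U U' : Fin (Module.finrank ℝ E) → ℝ → ℝ) (bu : Fin (Module.finrank ℝ E) → ℝ)
        (Ut : ℝ → ℝ) (pu : ℝ),
      (∀ i j, (h t).val y (e i) (e j) = if i = j then 1 else 0) ∧
      (∀ i, (∀ᶠ σ in 𝓝 (0 : ℝ), HasDerivAt (U i) (U' i σ) σ) ∧ HasDerivAt (U' i) (bu i) 0 ∧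
        U i 0 = Real.exp (-lam * (t - t₁)) * Φ (ψ y t) ∧
        ∀ᶠ σ in 𝓝 (0 : ℝ), U i σ ≤
          Real.exp (-lam * (t - t₁)) * Φ (ψ (expMap (h t).leviCivita y (σ • e i)) t)) ∧
      (HasDerivWithinAt Ut pu (Iic t) t ∧ Ut t = Real.exp (-lam * (t - t₁)) * Φ (ψ y t) ∧
        ∀ᶠ t' in 𝓝[<] t, Ut t' ≤ Real.exp (-lam * (t' - t₁)) * Φ (ψ y t')) ∧
      pu - ∑ i, bu i ≤ 0 + η := by
  intro η hη
  -- the constant `c = e^{-λ(t-t₁)} > 0` and the choice of `η₀` with `2 c (1 - Φ'(q₀)) η₀ = η`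
  obtain ⟨c, hc0, hc⟩ : ∃ c : ℝ, 0 < c ∧ Real.exp (-lam * (t - t₁)) = c :=
    ⟨_, Real.exp_pos _, rfl⟩
  have hΦ'1 : 0 < 1 - Φ' (ψ y t) := by linarith
  have hK0 : 0 < 2 * c * (1 - Φ' (ψ y t)) := by positivity
  obtain ⟨η₀, hη₀0, hη₀⟩ : ∃ η₀ : ℝ, 0 < η₀ ∧ 2 * c * (1 - Φ' (ψ y t)) * η₀ = η :=
    ⟨η / (2 * c * (1 - Φ' (ψ y t))), div_pos hη hK0, mul_div_cancel₀ η hK0.ne'⟩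
  obtain ⟨e, B, B', b, Bt, p, i₀, hon, hB, hBi₀, hBi, hBt, hsum, hp⟩ := hdat η₀ hη₀0
  rw [hc]
  refine ⟨e, fun i σ ↦ c * Φ (B i σ), fun i σ ↦ c * (Φ' (B i σ) * B' i σ),
    fun i ↦ c * (Φ''₀ * B' i 0 * B' i 0 + Φ' (B i 0) * b i),
    fun t' ↦ Real.exp (-lam * (t' - t₁)) * Φ (Bt t'),
    c * (-lam * Φ (Bt t) + Φ' (ψ y t) * p), hon, fun i ↦ ?_, ⟨?_, ?_, ?_⟩, ?_⟩
  · -- the space barriers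
    obtain ⟨hBd, hB2, hB0, hbar⟩ := hB i
    refine ⟨eventually_hasDerivAt_const_mul_comp hΦ1 hBd hB0, ?_, by simp only [hB0], ?_⟩
    · have hΦ2' : HasDerivAt Φ' Φ''₀ (B i 0) := by rw [hB0]; exact hΦ2
      exact hasDerivAt_const_mul_deriv_comp hΦ2' hBd.self_of_nhds hB2
    · filter_upwards [hbar] with σ hσ
      exact mul_le_mul_of_nonneg_left (hΦanti hσ) hc0.le
  · -- the time barrier: left derivative
    have hΦ1' : HasDerivAt Φ (Φ' (ψ y t)) (Bt t) := by rw [hBt.2.1]; exact hΦ1.self_of_nhds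
    have := hasDerivWithinAt_exp_mul_comp (lam := lam) (t₁ := t₁) hΦ1' hBt.1
    rwa [hc] at this
  · simp only [hBt.2.1, hc]
  · filter_upwards [hBt.2.2] with t' ht'
    exact mul_le_mul_of_nonneg_left (hΦanti ht') (Real.exp_pos _).le
  · -- the differential inequality
    have hsq : ∀ i, B' i 0 * B' i 0 = if i = i₀ then (2 * D) ^ 2 else 0 := by
      intro i
      split_ifs with hi
      · rw [hi, hBi₀]; ring
      · rw [hBi i hi]; ring
    have hsumbu : ∑ i, c * (Φ''₀ * B' i 0 * B' i 0 + Φ' (B i 0) * b i) =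
        c * (Φ''₀ * (2 * D) ^ 2 + Φ' (ψ y t) * ∑ i, b i) := by
      have hterm : ∀ i, c * (Φ''₀ * B' i 0 * B' i 0 + Φ' (B i 0) * b i) =
          c * Φ''₀ * (if i = i₀ then (2 * D) ^ 2 else 0) + c * Φ' (ψ y t) * b i := by
        intro i
        rw [← hsq i, (hB i).2.2.1]; ring
      rw [Finset.sum_congr rfl (fun i _ ↦ hterm i), Finset.sum_add_distrib, ← Finset.mul_sum,
        ← Finset.mul_sum, Finset.sum_ite_eq']
      simp only [Finset.mem_univ, if_true]
      ring
    rw [hsumbu, hBt.2.1]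
    have h1 : Φ' (ψ y t) * p ≤ Φ' (ψ y t) * (-Pl - η₀) := mul_le_mul_of_nonpos_left hp hΦ'0
    have h2 : Φ' (ψ y t) * (S + η₀) ≤ Φ' (ψ y t) * ∑ i, b i :=
      mul_le_mul_of_nonpos_left hsum hΦ'0
    have h3 : -lam * Φ (ψ y t) + Φ' (ψ y t) * p - (Φ''₀ * (2 * D) ^ 2 + Φ' (ψ y t) * ∑ i, b i) ≤
        2 * η₀ * -Φ' (ψ y t) := by
      linarith
    have h4 : c * (2 * η₀ * -Φ' (ψ y t)) ≤ η := by
      have h5 : c * (2 * η₀ * -Φ' (ψ y t)) = η - 2 * (c * η₀) := by rw [← hη₀]; ring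
      rw [h5]
      linarith [mul_pos hc0 hη₀0]
    calc c * (-lam * Φ (ψ y t) + Φ' (ψ y t) * p) -
          c * (Φ''₀ * (2 * D) ^ 2 + Φ' (ψ y t) * ∑ i, b i)
        = c * (-lam * Φ (ψ y t) + Φ' (ψ y t) * p -
            (Φ''₀ * (2 * D) ^ 2 + Φ' (ψ y t) * ∑ i, b i)) := by ring
      _ ≤ c * (2 * η₀ * -Φ' (ψ y t)) := mul_le_mul_of_nonneg_left h3 hc0.le
      _ ≤ η := h4
      _ = 0 + η := (zero_add η).symm

end Literature.Geometry.Riemannian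

end
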